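import Summits.Ventures.HSemireg.WedgeHankelStep

/-!
# Venture HSemireg — THEOREM H (3/4): the model on Fin (n+n), the recursion, the block Hankel law, hankelLaw_model

HONEST FRAMING. Part of the Lean index of the computation cell `pub-hsemireg` (seat p3; Sunday enclosure of the
FORMULA-N kernel assets of seats th-7 / th-6, ENCLOSURE-PLAN-p3.md).  Finite-dimensional exterior algebra over a field ONLY:
no variety, no cohomology theory, no semiregularity map is constructed here; nothing here says that HC / HC_CM / HC_AV holds;
no Literature fact is declared or used.  The geometric DICTIONARY (why these ranks are the `HT`-side box ranks of the cell's
STRUCTURE.md §1 / theory/FORMULA-N.md) lives in theory/FORMULA-N-th7.md PART B §A.3 / §N and is NOT asserted in Lean.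

THEOREM H, file 3 of 4 (th-7 HankelRank.lean l.891–1147): the concrete model on `In n := Fin (n+n)` — pairs `(x_m, y_m) = (e_m,
e_{n+m})`, the RECURSION `w₀(q) = q₀·1`, `w_{m+1}(q) = w_m(q)·x_m + w_m(σq)·y_m` (th-6's `vClass` in closed form, see file 4), the
blocks `Dm m` (first `m` pairs), and the main induction `finrank_JRsum_w : dim JRsum_k(Dm m; w_m ∘ q) = C(m,k) · rank 𝓗^{(m)}_k[q]`
(the BLOCK HANKEL LAW for arrays of sequences); then the single-sequence specialisation **`hankelLaw_model`**: for EVERY field `K`,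
all `n, k` and every `q : ℕ → K`, `dim range(θ ↦ θ ∧ w_n(q) on ⋀^k K^{2n}) = C(n,k) · rank (q_{i+s})_{i ≤ k, s ≤ n−k}` (for `k > n`
both sides are `0`).  th-7's statements and proofs, unchanged (namespace ↦ `Summit.Ventures.HSemireg.Wedge.Hankel`).
-/

open Module Set Set.powersetCard

namespace Summit.Ventures.HSemireg.Wedge.Hankel

variable (K : Type*) [Field K] {I : Type*} [LinearOrder I] [Fintype I]

section Model

variable (n : ℕ)

/-- the generator index type. -/
abbrev In : Type := Fin (n + n)

variable {n}

/-- index of `x_m`. -/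
def xI (m : ℕ) (h : m < n) : In n := ⟨m, by omega⟩
/-- index of `y_m`. -/
def yI (m : ℕ) (h : m < n) : In n := ⟨n + m, by omega⟩

variable (n)

/-- `x_m` (junk `0` for `m ≥ n`). -/
noncomputable def X (m : ℕ) : HT K (In n) := if h : m < n then gx K (xI m h) else 0
/-- `y_m` (junk `0` for `m ≥ n`). -/
noncomputable def Y (m : ℕ) : HT K (In n) := if h : m < n then gx K (yI m h) else 0

/-- THE RECURSION: `w₀(q) = q₀ · 1`, `w_{m+1}(q) = w_m(q) x_m + w_m(σq) y_m`.
Unfolded, `w_m(q) = Σ_{S ⊆ [m]} q_{|S|} Π_{a<m} (y_a if a ∈ S else x_a)` (ordered products) — th-6's `vClass`. -/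
noncomputable def w : ℕ → (ℕ → K) → HT K (In n)
  | 0, q => q 0 • (1 : HT K (In n))
  | m + 1, q => w m q * X K n m + w m (shift K q) * Y K n m

/-- the first `m` pairs. -/
def Dm (m : ℕ) : Finset (In n) :=
  Finset.univ.filter fun i => (i : ℕ) < m ∨ (n ≤ (i : ℕ) ∧ (i : ℕ) < n + m)

variable {n}

/-- `Dm 0 = ∅`. -/
lemma Dm_zero : Dm n 0 = ∅ := by
  ext i; simp [Dm]

/-- `Dm n = univ`: the first `n` pairs are all generators. -/
lemma Dm_top : Dm n n = Finset.univ := by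
  ext i
  simp only [Dm, Finset.mem_filter, Finset.mem_univ, true_and, iff_true]
  have := i.2
  omega

/-- `Dm (m+1) = Dm m ⊔ {x_m, y_m}`. -/
lemma Dm_succ {m : ℕ} (h : m < n) : Dm n (m + 1) = insert (xI m h) (insert (yI m h) (Dm n m)) := by
  ext i
  simp only [Dm, Finset.mem_filter, Finset.mem_univ, true_and, Finset.mem_insert, Fin.ext_iff, xI, yI]
  omega

/-- `x_m ∉ Dm m`. -/
lemma xI_notMem {m : ℕ} (h : m < n) : xI m h ∉ Dm n m := by
  simp [Dm, xI]; omega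

/-- `y_m ∉ Dm m`. -/
lemma yI_notMem {m : ℕ} (h : m < n) : yI m h ∉ Dm n m := by
  simp [Dm, yI]

/-- `x_m ≠ y_m` as indices. -/
lemma xI_ne_yI {m : ℕ} (h : m < n) : xI m h ≠ yI m h := by
  simp [xI, yI, Fin.ext_iff]; omega

/-- the empty monomial is `1`. -/
lemma B_empty : B K (In n) (∅ : Finset (In n)) = 1 := by
  rw [B, ExteriorAlgebra.basis_apply_ofCard (b K (In n)) (Finset.card_empty)]
  simp [ExteriorAlgebra.ιMulti_family]

/-- `Hom ∅ 0 = K · 1`. -/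
lemma Hom_empty_zero : Hom K (In n) ∅ 0 = K ∙ (1 : HT K (In n)) := by
  rw [Hom]
  congr 1
  ext v
  simp only [Set.mem_image, Set.mem_setOf_eq, Finset.subset_empty, Finset.card_eq_zero, and_self,
    Set.mem_singleton_iff]
  constructor
  · rintro ⟨s, rfl, rfl⟩; exact B_empty K
  · rintro rfl; exact ⟨∅, rfl, B_empty K⟩

/-- `Hom ∅ (k+1) = ⊥`. -/
lemma Hom_empty_succ (k : ℕ) : Hom K (In n) ∅ (k + 1) = ⊥ := by
  rw [Hom, Submodule.span_eq_bot]
  rintro _ ⟨s, ⟨hs, hc⟩, rfl⟩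
  rw [Finset.subset_empty] at hs
  subst hs
  simp at hc

/-- `w_m(q)` is homogeneous of degree `m`, supported on the first `m` pairs. -/
lemma w_mem_Hom {m : ℕ} (hm : m ≤ n) (q : ℕ → K) : w K n m q ∈ Hom K (In n) (Dm n m) m := by
  induction m generalizing q with
  | zero =>
    rw [w, Dm_zero, ← B_empty K]
    exact Submodule.smul_mem _ _ (B_mem_Hom K (Finset.empty_subset _) rfl)
  | succ m ih =>
    have h : m < n := by omega
    rw [w, X, Y, dif_pos h, dif_pos h, Dm_succ h]
    have hD : Dm n m ⊆ insert (xI m h) (insert (yI m h) (Dm n m)) := fun x hx =>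
      Finset.mem_insert_of_mem (Finset.mem_insert_of_mem hx)
    refine Submodule.add_mem _ ?_ ?_
    · have := mul_B_mem_Hom K hD (s := {xI m h}) (by simp) (ih (by omega) q)
      rwa [Finset.card_singleton] at this
    · have := mul_B_mem_Hom K hD (s := {yI m h}) (by simp) (ih (by omega) (shift K q))
      rwa [Finset.card_singleton] at this

/-- the base case `m = 0, k = 0`: the rank of the array `(q a j 0)`. -/
lemma finrank_base_zero {α β : Type} [Fintype α] [Fintype β] [DecidableEq α] [DecidableEq β]
    (q : α → β → ℕ → K) :
    Module.finrank K ↥(JRsum K (In n) ∅ 0 (fun a j => w K n 0 (q a j))) = (hank K 0 0 q).rank := by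
  -- T g = (g (j,0) • 1)_j is injective and carries the rows of `hank 0 0 q` to the generators of JRsum
  let T : (β × Fin 1 → K) →ₗ[K] (β → HT K (In n)) :=
    { toFun := fun g j => g (j, 0) • (1 : HT K (In n))
      map_add' := fun g h => by funext j; simp [add_smul]
      map_smul' := fun r g => by funext j; simp [smul_smul] }
  have hT : ∀ g, T g = 0 → g = 0 := by
    intro g hg
    funext ⟨j, i⟩
    have hi : i = 0 := Fin.ext (by have := i.2; omega)
    subst hi
    have := congr_fun hg j
    simp only [T, LinearMap.coe_mk, AddHom.coe_mk, Pi.zero_apply, smul_eq_zero] at this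
    rcases this with h | h
    · exact h
    · exact (one_ne_zero h).elim
  have hL1 : ∀ f : β → HT K (In n), L K f 1 = f := fun f => funext fun c => one_mul _
  have hJ : JRsum K (In n) ∅ 0 (fun a j => w K n 0 (q a j)) =
      (Submodule.span K (Set.range (hank K 0 0 q).row)).map T := by
    rw [Submodule.map_span, ← Set.range_comp, JRsum]
    have : ∀ a, JR K (In n) ∅ 0 (fun j => w K n 0 (q a j)) = K ∙ (fun j => w K n 0 (q a j)) := by
      intro a
      rw [JR, Hom_empty_zero, Submodule.map_span, Set.image_singleton, hL1]
    simp_rw [this]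
    rw [← Submodule.span_range_eq_iSup]
    congr 1
    ext f
    simp only [Set.mem_range, Function.comp_apply]
    constructor
    · rintro ⟨a, rfl⟩
      exact ⟨(a, 0), funext fun j => rfl⟩
    · rintro ⟨⟨a, i⟩, rfl⟩
      have hi : i = 0 := Fin.ext (by have := i.2; omega)
      subst hi
      exact ⟨a, funext fun j => rfl⟩
  rw [hJ, finrank_map_of_injOn K T _ (fun g _ hg => hT g hg), ← Matrix.rank_eq_finrank_span_row]

/-- **MAIN INDUCTION (block Hankel law):** for every array `q` of sequences,
`dim Σ_a JR_k(w_m ∘ q a) = C(m,k) · rank 𝓗^{(m)}_k[q]`. -/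
theorem finrank_JRsum_w {m : ℕ} (hm : m ≤ n) :
    ∀ (k : ℕ) (α β : Type) [Fintype α] [Fintype β] [DecidableEq α] [DecidableEq β]
      (q : α → β → ℕ → K),
      Module.finrank K ↥(JRsum K (In n) (Dm n m) k (fun a j => w K n m (q a j))) =
        m.choose k * (hank K m k q).rank := by
  induction m with
  | zero =>
    intro k α β _ _ _ _ q
    cases k with
    | zero => rw [Dm_zero, finrank_base_zero, Nat.choose_zero_right, one_mul]
    | succ k =>
      rw [Nat.choose_zero_succ, zero_mul, JRsum]
      have : ∀ a, JR K (In n) (Dm n 0) (k + 1) (fun j => w K n 0 (q a j)) = ⊥ := by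
        intro a; rw [JR, Dm_zero, Hom_empty_succ, Submodule.map_bot]
      rw [show (⨆ a, JR K (In n) (Dm n 0) (k + 1) fun j => w K n 0 (q a j)) = ⊥ from
        iSup_eq_bot.mpr this, finrank_bot]
  | succ m ih =>
    intro k α β _ _ _ _ q
    have h : m < n := by omega
    have ih' := ih (by omega)
    -- the recursion: w_{m+1} ∘ q = Fplus
    have hF : (fun a j => w K n (m + 1) (q a j)) =
        Fplus K (fun a j => w K n m (q a j)) (fun a j => w K n m (shift K (q a j))) (xI m h) (yI m h) := by
      funext a j
      simp only [w, X, Y, dif_pos h, Fplus]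
    have hcol : colDbl K (fun a j => w K n m (q a j)) (fun a j => w K n m (shift K (q a j))) =
        fun a j' => w K n m (qcol K q a j') := by
      funext a j'; rcases j' with j | j <;> rfl
    have hrow : rowDbl K (fun a j => w K n m (q a j)) (fun a j => w K n m (shift K (q a j))) =
        fun c j => w K n m (qrow K q c j) := by
      funext c j; rcases c with a | a <;> rfl
    have hF₁ : ∀ a j, w K n m (q a j) ∈ Hom K (In n) (Dm n m) m := fun a j => w_mem_Hom K (by omega) _
    have hF₂ : ∀ a j, w K n m (shift K (q a j)) ∈ Hom K (In n) (Dm n m) m :=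
      fun a j => w_mem_Hom K (by omega) _
    rw [hF, Dm_succ h]
    cases k with
    | zero =>
      rw [finrank_JRsum_zero K (xI_notMem h) (yI_notMem h) (xI_ne_yI h) hF₁ hF₂, hcol,
        ih' 0 α (β ⊕ β) (qcol K q), Nat.choose_zero_right, Nat.choose_zero_right,
        rank_hank_col K (Nat.zero_le m)]
    | succ k =>
      rw [finrank_JRsum_succ K (xI_notMem h) (yI_notMem h) (xI_ne_yI h) hF₁ hF₂, hcol, hrow,
        ih' (k + 1) α (β ⊕ β) (qcol K q), ih' k (α ⊕ α) β (qrow K q), rank_hank_row,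
        Nat.choose_succ_succ', add_mul, add_comm]
      congr 1
      by_cases hk : k + 1 ≤ m
      · rw [← rank_hank_col K hk, rank_hank_row]
      · rw [Nat.choose_eq_zero_of_lt (by omega), zero_mul, zero_mul]

/-! ### Stage 6: one sequence — the range of `θ ↦ θ ∧ w_n(q)` on `⋀^k` and the plain Hankel matrix -/

variable (n)

/-- `θ ↦ θ ∧ x` on `⋀^k N`, `N = K^{Fin (n+n)}`. -/
noncomputable def wedge (k : ℕ) (x : HT K (In n)) : (⋀[K]^k (In n → K)) →ₗ[K] HT K (In n) :=
  (LinearMap.mulRight K x) ∘ₗ (⋀[K]^k (In n → K)).subtype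

/-- the Hankel (catalecticant) matrix `H_k(q) = (q_{i+s})_{i ≤ k, s ≤ n−k}` (`n + 1 − k` columns; none if `k > n`). -/
def hankel1 (k : ℕ) (q : ℕ → K) : Matrix (Fin (k + 1)) (Fin (n + 1 - k)) K :=
  Matrix.of fun i s => q ((i : ℕ) + (s : ℕ))

variable {n}

/-- `⋀^k N` is the span of the degree-`k` monomials (all supports allowed). -/
lemma exteriorPower_eq_Hom_univ (k : ℕ) :
    (⋀[K]^k (In n → K) : Submodule K (HT K (In n))) = Hom K (In n) Finset.univ k := by
  have h1 : (⋀[K]^k (In n → K) : Submodule K (HT K (In n))) =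
      Submodule.map (⋀[K]^k (In n → K)).subtype ⊤ := by simp
  rw [h1, ← ((b K (In n)).exteriorPower k).span_eq, Submodule.map_span, ← Set.range_comp, Hom]
  congr 1
  ext x
  simp only [Set.mem_range, Function.comp_apply, Set.mem_image, Set.mem_setOf_eq, Finset.subset_univ,
    true_and]
  constructor
  · rintro ⟨s, rfl⟩
    refine ⟨s, card_eq s, ?_⟩
    simp [B, ExteriorAlgebra.basis_eq_coe_basis]
  · rintro ⟨s, hs, rfl⟩
    exact ⟨⟨s, by rw [mem_iff, hs]⟩,
      (ExteriorAlgebra.basis_eq_coe_basis (b K (In n)) (⟨s, by rw [mem_iff, hs]⟩ : powersetCard (In n) k)).symm⟩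

/-- the range of `θ ↦ θ ∧ x` on `⋀^k` is spanned by the `E_s ∧ x`, `|s| = k`. -/
lemma range_wedge (k : ℕ) (x : HT K (In n)) :
    LinearMap.range (wedge K n k x) = (Hom K (In n) Finset.univ k).map (LinearMap.mulRight K x) := by
  rw [wedge, LinearMap.range_comp, Submodule.range_subtype, exteriorPower_eq_Hom_univ]

/-- the one-row, one-column `JRsum` has the dimension of the range of `wedge` (via the injective `θ ↦ (θ)_{()}`). -/
lemma finrank_JRsum_unit (k : ℕ) (x : HT K (In n)) :
    Module.finrank K ↥(JRsum K (In n) Finset.univ k (fun (_ : Unit) (_ : Unit) => x)) =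
      Module.finrank K (LinearMap.range (wedge K n k x)) := by
  have hL : L K (fun _ : Unit => x) =
      (LinearMap.pi fun _ : Unit => (LinearMap.id : HT K (In n) →ₗ[K] HT K (In n))) ∘ₗ
        LinearMap.mulRight K x := by
    refine LinearMap.ext fun θ => funext fun c => ?_
    simp
  have hS : JRsum K (In n) Finset.univ k (fun (_ : Unit) (_ : Unit) => x) =
      JR K (In n) Finset.univ k (fun _ : Unit => x) := by
    rw [JRsum]
    exact iSup_const
  rw [hS, JR, hL, Submodule.map_comp, range_wedge,
    finrank_map_of_injOn K _ _ (fun g _ hg => by simpa using congr_fun hg ())]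

/-- the `Unit × _`-indexed block Hankel matrix of a single sequence is a reindexing of `hankel1`. -/
lemma rank_hank_unit (k : ℕ) (q : ℕ → K) :
    (hank K n k (fun (_ : Unit) (_ : Unit) => q)).rank = (hankel1 K n k q).rank := by
  have : hank K n k (fun (_ : Unit) (_ : Unit) => q) =
      (hankel1 K n k q).submatrix (Equiv.punitProd _) (Equiv.punitProd _) := by
    ext ⟨a, i⟩ ⟨c, s⟩
    rfl
  rw [this, Matrix.rank_submatrix]

/-- **THEOREM H (th-7 model form).** For every field `K`, all `n, k` and every coefficient sequence `q`:
`dim range(θ ↦ θ ∧ w_n(q) on ⋀^k K^{2n}) = C(n,k) · rank H_k(q)`, `H_k(q) = (q_{i+s})_{i ≤ k, s ≤ n−k}`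
(for `k > n` both sides are `0`). No hypothesis on `q`, no characteristic assumption. -/
theorem hankelLaw_model (k : ℕ) (q : ℕ → K) :
    Module.finrank K (LinearMap.range (wedge K n k (w K n n q))) = n.choose k * (hankel1 K n k q).rank := by
  rw [← finrank_JRsum_unit, ← rank_hank_unit, ← Dm_top]
  exact finrank_JRsum_w K le_rfl k Unit Unit (fun _ _ => q)

/-! ### Stage 7: the closed (unfolded) form of `w_m(q)` — an ORDERED binomial-type expansion -/

end Model

end Summit.Ventures.HSemireg.Wedge.Hankel
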